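/-
Origin: expansion seat `planner-pub-hodgecm-mc-glue-1-g11-0`, handover #SG45 2026-08-20T16:55:47Z md5 31bd59593c6f (REPLACE; pre md5 959936f5c4a8 → new md5 31bd59593c6f; 161 l.; (μ4) scope-guard rewrite of the RUN-55 installed file; family sanity-1; compiled ok 0 proof-hole) (`HOME/mc/pub-hodgecm-mc-glue-1-g11/stage56/HodgeCM/Model/Sanity/DegenerateClosureOGR21AEPI.lean`, md5 31bd59593c6f, 161 lines);
landed by the second packager p2 gen 10 (p2-g10) in gate run 56 REPLACES the earlier landed copy of `HodgeCM/Model/Sanity/DegenerateClosureOGR21AEPI.lean` (seat copy carried the packager Origin header of an earlier run (stripped)).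
-/
/-
Origin: SANITY lane `planner-pub-hodgecm-mc-sanity-1-g11-0` (unit pub-hodgecm-mc-sanity-1-g11, gen 11 of mc-sanity-1,
node SAN-27), 2026-08-20.  NEW additive KERNEL leaf `HodgeCM/Model/Sanity/DegenerateClosureOGR21AEPI.lean` over the
RUN-41-LANDED E TERM OF RECORD `HodgeCM.Model.perL_picardCM_r21AEOGI` (`Model/E2InstanceOGR21AEPI.lean`, glue-1 #394:
the GUARDED oriented E — canonical-representative guard `(NumberField.InfinitePlace.mk ι₁).embedding = ι₁` on the eight
class-hypothesis groups — INSTANTIATED at carch-1's bit of record `hb := orientBitι`; 14 binder groups) and the installed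
RUN-41 leaf `HodgeCM.Model.Sanity.DegenerateClosureOR21AE` (SAN-25; brings SAN-22 and every degenerate discharger).
Imported by nothing.  KERNEL: 0 records, 0 `Prop` definitions, 0 hypotheses minted, nothing cited, no instances; ONE
`abbrev` of a TYPE (`CdegSOG`, the guarded reading of SAN-25's `CdegSO`).
Expected `#print axioms`: ⊆ {propext, Classical.choice, Quot.sound}.
-/
import Summits.HodgeConjecture.HodgeCM.Model.E2InstanceOGR21AEPI
import Summits.HodgeConjecture.HodgeCM.Model.Sanity.DegenerateClosureOR21AE

/-!
# SAN-27 — the DEGENERATE CLOSURE of the E TERM OF RECORD at RUN 41, `perL_picardCM_r21AEOGI`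

MODEL-CONSTRUCTION sub-cell, SANITY lane (unit `pub-hodgecm-mc-sanity-1-g11`, node SAN-27).  KERNEL only; census leaf.

`Model.perL_picardCM_r21AEOGI` = `perL_picardCM_r21AEOG` at `hb := orientBitι`: the 14 groups
`hA W S μ hR hΘ C hT hpd hk gen12 real34 hyp12 hyp34` of the oriented E R21AEO with bit `orientBitι L ι₁` and, in the
eight class-hypothesis groups `hΘ C hpd hk gen12 real34 hyp12 hyp34`, ONE MORE hypothesis — the canonical-representative
guard `(NumberField.InfinitePlace.mk ι₁).embedding = ι₁` — after `Module.finrank ℚ c.K = 6`.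

Over the degenerate inhabitants `S := degS`, `W := zeroSK ∘ W` every Prop row is discharged for EVERY context by the
lane's per-context dischargers (bit explicit), so each guarded bullet simply ignores the guard:

* `CdegSOG` — the guarded oriented data binder type (E-OGI's group `C` at `S := degS`, `W := zeroSK ∘ W`, any bit `hb`;
  a `CdegSO` gives one by forgetting the guard); `isEmpty_cdegSOG_fibre` = SAN-10b.
* `perL_r21AEOGI_degS (h₃' hA W μ hR) (C : CdegSOG … orientBitι …) : (picardCMUniverse …).PerL` — ONE application of the
  E term of record with the seven Prop bullets of SAN-25 `perL_r21AEO_degS` at `hb := orientBitι`, each behind one more `_`.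
* `perL_r21AEOGI_degS_of_cdegSO` — in particular from SAN-25's un-guarded binder at `hb := orientBitι`.
* `perL_r21AEOGI_of_noCanonicalGoodSextic` — the E of record closes from toys EXACTLY modulo the GUARDED vacuity residual
  «no universe `(L, ι₁)` with `ι₁` the canonical representative of its place carries an anisotropic good sextic context
  for the model with bit `orientBitι L ι₁`» (stated inline).  NOTE (census, not a defect claim): unlike SAN-15's
  `NoGoodSextic` (refuted, SAN-15b) and SAN-25's oriented residual (refuted by theta-3's (O2) `Model.not_noGoodSextic₀O`),
  this residual is refuted only by a good-sextic witness AT A CANONICAL EMBEDDING `ι₁ = w.embedding` — (O2) does not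
  control `ι₁`; that one-line strengthening of the witness is left to the theta lane / gen 12 (SAN-28).

READING (census, MODEL-N ±0): binder groups of record 15 → 14 (row 1 `h` discharged by definition); over degenerate data
every remaining binder but `C` is free and `C` = `CdegSOG` (fibrewise empty) is the sole gatekeeper — toy-visible 14 → 14.
-/

set_option autoImplicit false

noncomputable section

namespace HodgeCM
namespace Model
namespace Sanity

open HodgeCM.Universe (SideData ThetaModel AdelicThetaCore AdelicTorusCore)
open HodgeCM.PerL34 HodgeCM.PerL34.ArchC
open Literature.AlgebraicGeometry.HodgeTheory Literature.NumberTheory.Automorphic.PicardCM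
open Literature.NumberTheory.Transcendental (Arapura2012_Cor_15_4_6)
open Literature.AlgebraicGeometry.ShimuraVarieties
open HodgeCM.Model.ThetaSpace
open HodgeCM.Model.SupplyResidual

variable (hHD : exists_isReal_hodgeModel) (hI : hodgePQ_independent_of_hodgeModel)
  (h₁ : BallQuotientUniformised)

/-- The GUARDED oriented data binder `C` of the E term of record read at `S := degS`, `W := zeroSK ∘ W` — SAN-25's
`CdegSO` with the canonical-representative guard `(NumberField.InfinitePlace.mk ι₁).embedding = ι₁` after the degree
hypothesis (verbatim shape of `Model.perL_picardCM_r21AEOGI`'s group `C`, for an arbitrary bit `hb`). -/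
abbrev CdegSOG (h₃ : CMAbelianVarietyRealised) (hb : ∀ L : CMField, (L →+* ℂ) → Bool) (hA : Arapura2012_Cor_15_4_6)
    (W : ∀ {L : CMField} {ι₁ : L →+* ℂ} (V : HermSpace3 L ι₁) (c : SeesawCtx L), WmInput V c.D)
    (μ : ∀ {L : CMField}, SeesawCtx L → Fin 4 → NumberField.InfinitePlace L → ℤ) : Type 1 :=
  ∀ {L : CMField} {ι₁ : L →+* ℂ} (V : HermSpace3 L ι₁) (c : SeesawCtx L) (hV : IsAnisotropic L V.Hm),
    (thetaModelOf hHD hI h₁ h₃ (hb L ι₁) (embOf hHD hI h₁ h₃) (coverOf hHD hI h₁ h₃ hA)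
      (wmOfInput fun V c => (W V c).zeroSK)
      (thetaOf _ (thetaClassInputOf _ (fun V c => thetaSpaceInputOf hHD hI h₁ h₃ degS V c))) (d12Of μ)
      (d34Of μ)).GoodCtx ι₁ c →
    Module.finrank ℚ c.K = 6 → (NumberField.InfinitePlace.mk ι₁).embedding = ι₁ →
      ∀ k : Fin 4, k = 0 ∨ k = 1 → ∀ N : ℕ, 0 < N →
        ArchKTypeData (thetaSpaceInputIn hHD hI h₁ h₃ (degS V c) hV) k N

/-- The fibre of the guarded binder over an anisotropic context is EMPTY, whatever the bit and the guard (SAN-10b). -/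
theorem isEmpty_cdegSOG_fibre (h₃ : CMAbelianVarietyRealised) {L : CMField} {ι₁ : L →+* ℂ} (V : HermSpace3 L ι₁)
    (c : SeesawCtx L) (hV : IsAnisotropic L V.Hm) :
    IsEmpty (∀ k : Fin 4, k = 0 ∨ k = 1 → ∀ N : ℕ, 0 < N →
      ArchKTypeData (thetaSpaceInputIn hHD hI h₁ h₃ (degS V c) hV) k N) :=
  isEmpty_C_fibre_degS hHD hI h₁ h₃ V c hV

/-- **The E term of record at RUN 41, `perL_picardCM_r21AEOGI`, over the degenerate data closes PerL modulo the single
binder `C`** — the seven Prop-row discharges of SAN-25 `perL_r21AEO_degS` at the bit of record `orientBitι L ι₁`, each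
guarded group ignoring its canonical-representative guard. -/
theorem perL_r21AEOGI_degS (h₃' : CMAbelianVarietyEigenbasisRealised) (hA : Arapura2012_Cor_15_4_6)
    (W : ∀ {L : CMField} {ι₁ : L →+* ℂ} (V : HermSpace3 L ι₁) (c : SeesawCtx L), WmInput V c.D)
    (μ : ∀ {L : CMField}, SeesawCtx L → Fin 4 → NumberField.InfinitePlace L → ℤ)
    (hR : DeligneMilne1982_Thm_6_20_full)
    (C : CdegSOG hHD hI h₁ (cmAbelianVarietyRealised_of_eigenbasis hHD hI h₃') orientBitι hA W μ) :
    (picardCMUniverse hHD hI h₁ (cmAbelianVarietyRealised_of_eigenbasis hHD hI h₃')).PerL := by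
  refine perL_picardCM_r21AEOGI hHD hI h₁ h₃' hA (fun V c => (W V c).zeroSK) degS μ hR
    ?_ (fun V c hV hc h6 hcan => C V c hV hc h6.1 hcan) ?_ ?_ ?_ ?_ ?_ ?_ ?_
  · -- `hΘ` at the bit of record, guard ignored — SAN-22
    intro L ι₁ V c _ _ _ i
    exact hTheta_degS hHD hI h₁ _ (orientBitι L ι₁) (embOf hHD hI h₁ _) (coverOf hHD hI h₁ _ hA)
      (wmOfInput fun V c => (W V c).zeroSK) (d12Of μ) (d34Of μ) V c i
  · -- `hT`
    intro L ι₁ V c k N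
    exact isThetaArchContinuous_degS V c k N
  · -- `hpd` — vacuous over the empty `C`-fibre
    intro L ι₁ V c hV hc h6 hcan k hk N hN
    exact ((isEmpty_C_fibre_degS hHD hI h₁ _ V c hV).false (C V c hV hc h6.1 hcan)).elim
  · -- `hk` (along form)
    intro L ι₁ V c hV hc h6 hcan k hk N hN p
    exact ((isEmpty_C_fibre_degS hHD hI h₁ _ V c hV).false (C V c hV hc h6.1 hcan)).elim
  · -- `gen12`, guard ignored
    intro L ι₁ V c hc h6 _
    exact gen12_degS' hHD hI h₁ _ (orientBitι L ι₁) (embOf hHD hI h₁ _) (coverOf hHD hI h₁ _ hA)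
      (fun V c => (W V c).zeroSK) μ V c hc h6.1
  · -- `real34`, guard ignored
    intro L ι₁ V c _ _ _
    exact real34_zeroSK (embOf hHD hI h₁ _) (coverOf hHD hI h₁ _ hA) W _ (orientBitι L ι₁) (d12Of μ)
      (d34Of μ) V c
  · -- `hyp12`, guard ignored
    intro L ι₁ V c _ _ _
    exact hyp12_zeroSK (embOf hHD hI h₁ _) (coverOf hHD hI h₁ _ hA) W _ (orientBitι L ι₁) _ _ _ V c
  · -- `hyp34`, guard ignored
    intro L ι₁ V c _ _ _
    exact hyp34_zeroSK (embOf hHD hI h₁ _) (coverOf hHD hI h₁ _ hA) W _ (orientBitι L ι₁) _ _ _ V c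

/-- … in particular from SAN-25's un-guarded oriented binder at the bit of record. -/
theorem perL_r21AEOGI_degS_of_cdegSO (h₃' : CMAbelianVarietyEigenbasisRealised) (hA : Arapura2012_Cor_15_4_6)
    (W : ∀ {L : CMField} {ι₁ : L →+* ℂ} (V : HermSpace3 L ι₁) (c : SeesawCtx L), WmInput V c.D)
    (μ : ∀ {L : CMField}, SeesawCtx L → Fin 4 → NumberField.InfinitePlace L → ℤ)
    (hR : DeligneMilne1982_Thm_6_20_full)
    (C : CdegSO hHD hI h₁ (cmAbelianVarietyRealised_of_eigenbasis hHD hI h₃') orientBitι hA W μ) :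
    (picardCMUniverse hHD hI h₁ (cmAbelianVarietyRealised_of_eigenbasis hHD hI h₃')).PerL :=
  perL_r21AEOGI_degS hHD hI h₁ h₃' hA W μ hR fun V c hV hc h6 _ => C V c hV hc h6

/-- **The E term of record closes from the degenerate data EXACTLY modulo the GUARDED vacuity residual** «no universe
`(L, ι₁)` with `ι₁` canonical for its place carries an anisotropic good seesaw context of degree 6 for the model with
bit `orientBitι L ι₁`» (inline; refutable only by a good-sextic witness at a canonical embedding — see the header). -/
theorem perL_r21AEOGI_of_noCanonicalGoodSextic (h₃' : CMAbelianVarietyEigenbasisRealised)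
    (hA : Arapura2012_Cor_15_4_6)
    (W : ∀ {L : CMField} {ι₁ : L →+* ℂ} (V : HermSpace3 L ι₁) (c : SeesawCtx L), WmInput V c.D)
    (μ : ∀ {L : CMField}, SeesawCtx L → Fin 4 → NumberField.InfinitePlace L → ℤ)
    (hR : DeligneMilne1982_Thm_6_20_full)
    (hno : ∀ {L : CMField} {ι₁ : L →+* ℂ} (V : HermSpace3 L ι₁) (c : SeesawCtx L), IsAnisotropic L V.Hm →
      (thetaModelOf hHD hI h₁ (cmAbelianVarietyRealised_of_eigenbasis hHD hI h₃') (orientBitι L ι₁)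
        (embOf hHD hI h₁ (cmAbelianVarietyRealised_of_eigenbasis hHD hI h₃'))
        (coverOf hHD hI h₁ (cmAbelianVarietyRealised_of_eigenbasis hHD hI h₃') hA)
        (wmOfInput fun V c => (W V c).zeroSK)
        (thetaOf _ (thetaClassInputOf _ (fun V c =>
          thetaSpaceInputOf hHD hI h₁ (cmAbelianVarietyRealised_of_eigenbasis hHD hI h₃') degS V c)))
        (d12Of μ) (d34Of μ)).GoodCtx ι₁ c →
      Module.finrank ℚ c.K = 6 → (NumberField.InfinitePlace.mk ι₁).embedding ≠ ι₁) :
    (picardCMUniverse hHD hI h₁ (cmAbelianVarietyRealised_of_eigenbasis hHD hI h₃')).PerL :=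
  perL_r21AEOGI_degS hHD hI h₁ h₃' hA W μ hR fun V c hV hc h6 hcan => (hno V c hV hc h6 hcan).elim

end Sanity
end Model
end HodgeCM

end
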